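import Literature.NumberTheory.LFunctions.DirichletZeroDensitySevenThirds
import Literature.NumberTheory.LFunctions.ExplicitFormulaPsiChar
import HarnessLib

/-!
# Chen–Gupta–Li, Theorem 1.2 («In all cases»): the `7/3` zero-density theorem for the family
# `{L(s, χ)}_{χ mod q}` with the zeros COUNTED WITH MULTIPLICITY

LABEL (C5 / rh-crit-ah, LADDER-RH §4 HELD «conditional bridges: exceptional zero ⇒ …»):
**NOT RH-BEARING.** This module re-types ONE printed display of an RH-FREE published zero-density
theorem (B. Chen, V. Gupta, Y. C. Li, arXiv:2507.08296**v2**, Theorem 1.2, the «In all cases»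
clause) as a named fact, with the zero count read WITH MULTIPLICITY; typing a published theorem is
transcription, not progress toward RH; nothing here bears on the truth of RH.

Topic `Literature/NumberTheory/LFunctions`, paper sub-namespace
`Literature.NumberTheory.LFunctions.ChenGuptaLi2025` — the SAME sub-namespace as the sibling
statement module `DirichletZeroDensitySevenThirds.lean`, which types the paper's §1 (Theorems 1.1,
1.2, Corollaries 1.3, 1.5) over the DISTINCT-zero count
`ThornerZaman2024PNTAP.modZeroCount q σ T = Σ_{χ mod q} (zeroSetGe χ σ T).ncard` (`Set.ncard`, its
docstring: «the reading print's "number of zeros" certainly implies»). VOCABULARY REUSED, NOT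
RE-DECLARED: the printed zero set `{ρ = β + it : L(ρ, χ) = 0, σ ≤ β ≤ 1, |t| ≤ T}` is the tree's
`ThornerZaman2024PNTAP.zeroSetGe χ σ T` (file `RepulsiveLogFreeDensitySingleModulus.lean`; for
`σ > 0` the printed `β ≤ 1` is automatic, `zeroSetGe_subset_lfunctionZeroBox` below), and the
multiplicity of a zero is the tree's `DirichletDisc.zeroOrder χ ρ` (Mathlib's `analyticOrderNatAt`,
file `DirichletLogDerivDisc.lean`) — the same device as Bondarenko–Heap's typed count
`BondarenkoHeap2026.charZeroCountRe` (`BondarenkoHeap2026Sections3to5.lean`).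

## Why a multiplicity twin

Bondarenko–Heap (arXiv:2608.07399, Proposition 2 = the tree's named fact `BondarenkoHeap2026.prop2`)
quote this theorem for zeros COUNTED WITH MULTIPLICITY (their `N(σ, H, ψ)` feeds an explicit
formula, where every zero enters with its multiplicity). The distinct-zero rendering
`ChenGuptaLi2025.theorem12_allCases` cannot imply such a statement (short of the simplicity of all
zeros), so the consumer-facing reading is typed here, once, beside it. The multiplicity reading is
the standard meaning of `N(σ, T, χ)` (Davenport, *Multiplicative Number Theory*, Ch. 16 — the
reference the paper itself invokes for `N(σ, T+1, χ) − N(σ, T, χ) ≪ log qT`, v2 TeX l.2158 — counts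
zeros according to multiplicity), and the paper's zero-detection proof (§12) treats a multiple zero
exactly like a simple one.

## What the source prints (v2 = the cite of record; TeX source of record
## `run/shared/lean/pub/rh-crit/ah/src/ChenGuptaLi2025_arXiv2507.08296v2.tex`, sha256 `0b9ebb6b…`;
## PDF p. 3; the held corpus text `paper:arxiv-2507.08296` is the superseded v1 with a different
## numbering — do not read numbers off it)

(l.141) "Let `N(σ,T,χ)` denote the number of zeros `ρ = β+it` of `L(s,χ)` in the rectangle
`σ ≤ β ≤ 1`, `|t| ≤ T`."

> **Theorem 1.2** (Zero-density estimate; l.158–186). For any divisor `q₁ ∣ q` and `1/2 < σ < 1`,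
> we have `Σ_{χ mod q} N(σ,T,χ) ≤ (qT)^{o(1)}((q₁^{1/3}qT)^{3(1−σ)/(1+σ)} + (qT(q₁T)^{−1/2})^{3(1−σ)/σ}
> + (q₁T)^{−1/2}(qT)^{(21−20σ)/6} + (qT)^{15(1−σ)/(3+5σ)})`.
> If `q₁ ∣ q` and `q₁ ≥ √q`, we also have `Σ_{χ mod q} N(σ,T,χ) ≤ (qT)^{o(1)}((q₁^{1/3}q²T²)^{1−σ}
> + (q³T^{9/4}q₁^{−3/4})^{1−σ} + (qT)^{B(1−σ)} + (qT)^{30(1−σ)/13})`, where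
> `B = (37 + 3β − √(9β² + 222β − 71))/12` and `β = log(q₁T)/log(qT)`.
> **In all cases, we have `Σ_{χ mod q} N(σ,T,χ) ≤ (qT)^{o(1)}(q^{7(1−σ)/3}T^{2(1−σ)} + (qT)^{30(1−σ)/13})`.**
> If `q` is `T`-smooth, then `Σ_{χ mod q} N(σ,T,χ) ≤ (qT)^{30(1−σ)/13 + o(1)}`.

§1.1 Notation (l.269–270): "we write `A ⪅ B` to indicate that for any `ε > 0`, there exists a
constant `C(ε) > 0`, depending only on `ε`, such that `A ≤ C(ε)(qT)^ε B` for all sufficiently large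
`qT`. … Asymptotic quantities such as `o(1)` are interpreted as `qT → ∞`."

## Lean rendering (this file)

* Only the «In all cases» display is typed here (`theorem12_allCases_mult`); the two `q₁`-divisor
  displays and the `T`-smooth display are quoted above and typed (distinct-zero reading) in the
  sibling module. -- TODO(general form): multiplicity twins of the other three displays if a
  consumer ever needs them.
* `(qT)^{o(1)}` with `σ` FIXED: for every `σ ∈ (1/2, 1)` and every `ε > 0` there is `C = C(σ, ε) > 0`
  with `Σ_χ N(σ,T,χ) ≤ C (qT)^ε (…)` for all `q ≥ 1`, `T ≥ 1`. The print lets `qT → ∞` at fixed `σ`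
  and claims uniformity "in `q` and `T`" only (l.187), so NO uniformity in `σ` is asserted (the
  sibling module's `theorem12_allCases` chose a `σ`-uniform constant; the present fact is, in that
  respect, the weaker reading). `T ≥ 1` records that the print's `T` is a height (the clause "for
  all sufficiently large `qT`" is absorbed into `C`: for bounded `qT` with `T ≥ 1` the left side is
  a bounded count and the right side is `≥ C`).
* PROVED bookkeeping: `zeroSetGe_subset_lfunctionZeroBox`, `zeroSetGe_finite` (non-principal `χ`,
  `σ > 0`), `charZeroCountMult_eq_sum`, `charZeroCountGe_le_charZeroCountMult` (the distinct count
  is at most the multiplicity count, non-principal `χ`, `σ > 0`), and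
  `sevenThirds_mult_of_allCases_mult` (the display gives `≤ 2C (qT)^{7(1−σ)/3+ε}`, by the sibling's
  `allCases_bound_le`).
* No instances, no notation; one named fact.

References: [cite: ChenGuptaLi2025, Theorem 1.2 («In all cases»), arXiv v2 TeX l.178–182, p. 3;
l.141 (definition of N(σ,T,χ)); §1.1 l.269–270 (conventions)].
-/

noncomputable section

open scoped Classical
open Complex Finset

namespace Literature.NumberTheory.LFunctions

namespace ChenGuptaLi2025

open ThornerZaman2024PNTAP (zeroSetGe charZeroCountGe modZeroCount)
open DirichletDisc (zeroOrder)

/-! ### The multiplicity count -/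

/-- **`N(σ, T, χ)` counted with multiplicity**: the sum of the multiplicities
`m(ρ) = DirichletDisc.zeroOrder χ ρ` over the printed zero set
`zeroSetGe χ σ T = {ρ : L(ρ, χ) = 0, σ ≤ Re ρ, |Im ρ| ≤ T}` (a `finsum`; a genuine finite sum for
`χ ≠ χ₀` and `σ > 0`, `charZeroCountMult_eq_sum`). (l.141: "the number of zeros `ρ = β + it` of
`L(s, χ)` in the rectangle `σ ≤ β ≤ 1`, `|t| ≤ T`".)
[cite: ChenGuptaLi2025, §1 (definition of N(σ,T,χ)), arXiv v2 TeX l.141] -/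
def charZeroCountMult {q : ℕ} [NeZero q] (χ : DirichletCharacter ℂ q) (σ T : ℝ) : ℕ :=
  ∑ᶠ ρ ∈ zeroSetGe χ σ T, zeroOrder χ ρ

/-- **`Σ_{χ mod q} N(σ, T, χ)` counted with multiplicity** (all characters modulo `q`, the
principal one included, as printed). [cite: ChenGuptaLi2025, Theorem 1.2 (left-hand side)] -/
def modZeroCountMult (q : ℕ) [NeZero q] (σ T : ℝ) : ℕ :=
  ∑ χ : DirichletCharacter ℂ q, charZeroCountMult χ σ T

/-! ### The named fact -/

/-- **Chen–Gupta–Li, Theorem 1.2** («In all cases» display), zeros COUNTED WITH MULTIPLICITY: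
"In all cases, we have `Σ_{χ mod q} N(σ,T,χ) ≤ (qT)^{o(1)}(q^{7(1−σ)/3}T^{2(1−σ)} + (qT)^{30(1−σ)/13})`"
(for `1/2 < σ < 1`; `N(σ,T,χ)` = "the number of zeros `ρ = β+it` of `L(s,χ)` in the rectangle
`σ ≤ β ≤ 1`, `|t| ≤ T`", read with multiplicity). Rendered with `σ` FIXED and the paper's
`(qT)^{o(1)}`-convention (§1.1: for every `ε > 0` a constant, `qT → ∞`): for every `σ ∈ (1/2, 1)`
and every `ε > 0` there is `C > 0` such that for every modulus `q ≥ 1` and every `T ≥ 1`,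
`Σ_{χ mod q} N(σ,T,χ) ≤ C (qT)^ε (q^{7(1−σ)/3} T^{2(1−σ)} + (qT)^{30(1−σ)/13})`
(`modZeroCountMult`; no uniformity in `σ` is asserted). Status: theorem-in-print (v2); a NAMED FACT
(corpus FACT-LIST boundary: the external input behind Bondarenko–Heap's Proposition 2). The
distinct-zero reading of the same display is `theorem12_allCases` (sibling module).
[cite: ChenGuptaLi2025, Theorem 1.2 («In all cases»), arXiv v2 TeX l.178–182, p. 3] -/
def theorem12_allCases_mult : Prop :=
  ∀ σ : ℝ, 1 / 2 < σ → σ < 1 → ∀ ε : ℝ, 0 < ε → ∃ C : ℝ, 0 < C ∧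
    ∀ (q : ℕ) [NeZero q] (T : ℝ), 1 ≤ T →
      (modZeroCountMult q σ T : ℝ) ≤ C * ((q : ℝ) * T) ^ ε *
        ((q : ℝ) ^ (7 * (1 - σ) / 3) * T ^ (2 * (1 - σ)) + ((q : ℝ) * T) ^ (30 * (1 - σ) / 13))

/-! ### Bookkeeping (proved) -/

/-- For `χ ≠ χ₀` and `σ > 0` the printed zero set `{L(ρ,χ) = 0, σ ≤ Re ρ, |Im ρ| ≤ T}` lies in the
tree's box of non-trivial zeros `lfunctionZeroBox χ T` (`L(s, χ) ≠ 0` for `Re s ≥ 1`, so the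
printed `β ≤ 1` is automatic and in fact `β < 1`). [cite: ChenGuptaLi2025, §1 (definition of N(σ,T,χ)), l.141] -/
theorem zeroSetGe_subset_lfunctionZeroBox {q : ℕ} [NeZero q] {χ : DirichletCharacter ℂ q}
    (hχ : χ ≠ 1) {σ : ℝ} (hσ : 0 < σ) (T : ℝ) :
    zeroSetGe χ σ T ⊆ lfunctionZeroBox χ T := by
  rintro ρ ⟨h0, hσρ, hT⟩
  refine ⟨h0, lt_of_lt_of_le hσ hσρ, ?_, hT⟩
  by_contra hre
  exact DirichletCharacter.LFunction_ne_zero_of_one_le_re χ (Or.inl hχ) (not_lt.mp hre) h0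

/-- For `χ ≠ χ₀` and `σ > 0` the printed zero set is finite (it lies in the compact part
`[0, 1] × [−T, T]` of the critical strip and the zeros of the entire `L(s, χ)` are isolated), so the
multiplicity count is a genuine finite sum. [cite: ChenGuptaLi2025, §1 (definition of N(σ,T,χ)), l.141] -/
theorem zeroSetGe_finite {q : ℕ} [NeZero q] {χ : DirichletCharacter ℂ q} (hχ : χ ≠ 1) {σ : ℝ}
    (hσ : 0 < σ) (T : ℝ) : (zeroSetGe χ σ T).Finite :=
  (lfunctionZeroBox_finite hχ T).subset (zeroSetGe_subset_lfunctionZeroBox hχ hσ T)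

/-- The multiplicity count as a `Finset` sum over the finite zero set (`χ ≠ χ₀`, `σ > 0`).
[cite: ChenGuptaLi2025, §1 (definition of N(σ,T,χ)), l.141] -/
theorem charZeroCountMult_eq_sum {q : ℕ} [NeZero q] {χ : DirichletCharacter ℂ q} (hχ : χ ≠ 1)
    {σ : ℝ} (hσ : 0 < σ) (T : ℝ) :
    charZeroCountMult χ σ T = ∑ ρ ∈ (zeroSetGe_finite hχ hσ T).toFinset, zeroOrder χ ρ := by
  rw [charZeroCountMult, finsum_mem_eq_finite_toFinset_sum _ (zeroSetGe_finite hχ hσ T)]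

/-- **Distinct count ≤ multiplicity count** (`χ ≠ χ₀`, `σ > 0`): every zero in the printed set has
multiplicity `m(ρ) ≥ 1` (`DirichletDisc.zeroOrder_pos_iff`), so the sibling module's
`charZeroCountGe χ σ T = (zeroSetGe χ σ T).ncard` is at most `charZeroCountMult χ σ T`.
[cite: ChenGuptaLi2025, §1 (definition of N(σ,T,χ)), l.141] -/
theorem charZeroCountGe_le_charZeroCountMult {q : ℕ} [NeZero q] {χ : DirichletCharacter ℂ q}
    (hχ : χ ≠ 1) {σ : ℝ} (hσ : 0 < σ) (T : ℝ) :
    charZeroCountGe χ σ T ≤ charZeroCountMult χ σ T := by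
  have hfin := zeroSetGe_finite hχ hσ T
  rw [charZeroCountGe, charZeroCountMult_eq_sum hχ hσ T, Set.ncard_eq_toFinset_card _ hfin,
    Finset.card_eq_sum_ones]
  refine Finset.sum_le_sum fun ρ hρ ↦ ?_
  rw [Set.Finite.mem_toFinset] at hρ
  exact (DirichletDisc.zeroOrder_pos_iff χ hχ ρ).2 hρ.1

/-- **The `7/3` headline with multiplicity**: the «In all cases» display gives, for every
`σ ∈ (1/2, 1)` and `ε > 0`, a constant `C` with `Σ_{χ mod q} N(σ,T,χ) ≤ C (qT)^{7(1−σ)/3+ε}`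
(`q, T ≥ 1`; multiplicities counted) — by the sibling module's `allCases_bound_le`
(`q^{7(1−σ)/3}T^{2(1−σ)} + (qT)^{30(1−σ)/13} ≤ 2 (qT)^{7(1−σ)/3}`).
[cite: ChenGuptaLi2025, Abstract and §1 l.187 ("the best exponent … is A = 7/3")] -/
theorem sevenThirds_mult_of_allCases_mult (h : theorem12_allCases_mult) :
    ∀ σ : ℝ, 1 / 2 < σ → σ < 1 → ∀ ε : ℝ, 0 < ε → ∃ C : ℝ, 0 < C ∧
      ∀ (q : ℕ) [NeZero q] (T : ℝ), 1 ≤ T →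
        (modZeroCountMult q σ T : ℝ) ≤ C * ((q : ℝ) * T) ^ (7 * (1 - σ) / 3 + ε) := by
  intro σ hσ hσ' ε hε
  obtain ⟨C, hC, hmain⟩ := h σ hσ hσ' ε hε
  refine ⟨2 * C, by positivity, fun q _ T hT ↦ ?_⟩
  have hq : (1 : ℝ) ≤ q := by exact_mod_cast Nat.one_le_iff_ne_zero.2 (NeZero.ne q)
  have hqT0 : (0 : ℝ) ≤ q * T := by positivity
  have hB := allCases_bound_le hq hT hσ'
  have hε0 : 0 ≤ ((q : ℝ) * T) ^ ε := Real.rpow_nonneg hqT0 _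
  calc (modZeroCountMult q σ T : ℝ)
      ≤ C * ((q : ℝ) * T) ^ ε * ((q : ℝ) ^ (7 * (1 - σ) / 3) * T ^ (2 * (1 - σ)) +
          ((q : ℝ) * T) ^ (30 * (1 - σ) / 13)) := hmain q T hT
    _ ≤ C * ((q : ℝ) * T) ^ ε * (2 * ((q : ℝ) * T) ^ (7 * (1 - σ) / 3)) :=
        mul_le_mul_of_nonneg_left hB (mul_nonneg hC.le hε0)
    _ = 2 * C * ((q : ℝ) * T) ^ (7 * (1 - σ) / 3 + ε) := by
        rw [Real.rpow_add (by positivity)]; ring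

end ChenGuptaLi2025

end Literature.NumberTheory.LFunctions
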